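import Summits.QuantumFields.YangMills.Theorems.TwistedTraceScaling.Negative.ActionWindowSchedule
import Summits.QuantumFields.YangMills.Theorems.LuscherReductionTwistedTraceScalingBTRatesKappa
import HarnessLib

/-!
# R53S (crux `TwistedTraceScaling`, stmt-QuantumFields-20203): the (C4) CORE-DEFECT constant of `core_transfer_defect_le` on schedule B with the landed slow window
# `𝒰_β = {δu-ball ∧ L³S ≤ β^{-1/3}}` (p703178) is NOT `hb_small`-admissible — for ANY window radii, ANY `η_c ≥ 0`, ANY constant

Standing disprover `ym-cdisprove-20203-1` (gen 42), sequel to R53 (`…Negative.ActionWindowSchedule`) and R53R.  Lane A's announced step 2 (HANDOFF-g18 «NEXT SEAT», 2026-08-29) feeds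
the (C1) record into `…BOCoreDefectPointwise.core_transfer_defect_le`, whose defect constant is, VERBATIM,
`ε = max (1 − e^{−η}(1 − η_c)) (e^{η}(1 + η_c) − 1)`, `η = coreEta L β δ (δ+δu) T R Γ σ + coreEps1 L β δ T R + coreEps2 L β δ T R σ`,
with `σ` = the one-site action ceiling of the slow window `𝒰_β` (`hS'`, `hφw`) — in the landed record `σ = powScale (1/3) β` — and `T` = schedule B.  Then (`…BODefect.hOD_of_defect`)
the (B-OD) rate `b` carries `ε` (times the `O(1)` ratio `c₁P/Λ`).
* §1 `coreEta_zero_le` (`coreEta L β 0 0 T 0 0 σ ≤ coreEta L β δ α T R Γ σ` for nonnegative data: the action term is monotone-free of the radii),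
  `exponent_ge_coreEta_zero` (`η ≥ coreEta L β 0 0 T 0 0 σ`, adding `coreEps1, coreEps2 ≥ 0`).
* §2 `le_defectConst` (`η ≤ ε` whenever `η_c ≥ 0`: `e^{η}(1+η_c) − 1 ≥ e^{η} − 1 ≥ η`), `etac_le_defectConst` (`η_c ≤ ε` whenever `η ≥ 0`).
* §3 ★★★ `not_hb_small_of_coreDefect_third`: for all radii `δ, δu ≥ 0`, all `R`, all `Γ ≥ 0`, all `η_c ≥ 0` (eventually) and every constant `c > 0`,
  `(∀ᶠ β, c·ε(β) ≤ b(β)) → ¬ (∀ a > 0, ∀ᶠ β, b(β)² ≤ a·λ_b(L³β))` — R53's action floor `3456·2025·N_P·L²ℓ⁴β^{-1/6}` survives every other choice;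
  ★★ `not_hb_small_of_scaled_exponent` (same with `c·η ≤ b`), and `core_defect_budget_false` (the (OD) clause `∃β₀ ∀β ≥ β₀ ∃b, ε ≤ b ∧ b² ≤ εθλ_b/16` is false ∀ ε, θ).
REPAIR (unchanged, R53/R53R): raise the action ceiling of `𝒰_β` to `σ := powScale q β`, `1/3 < q` (e.g. `q = 1/2`; R53R `repaired_recordExponent_hb_small` prices the whole
`δ = 0` exponent at `O(L¹⁰ℓ⁸β^{-1/4})`); `𝒰_β` must still contain the slow means of the tube (action `O(L³δ(β)²) = O(L³β^{-1}ℓ²)`), so any `q < 1` is admissible there.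
READING: every theorem quoted is TRUE as landed; this prices one schedule constant before (C4) is written on it.  HONEST FRAMING: stub of a child of the CONDITIONAL reduction
route R2b1; (C4), (C5), (B-ST), C4-CORE OPEN; not infinite volume, not a gap, not Clay.
-/

set_option autoImplicit false

noncomputable section

open Real Filter
open Literature.MathematicalPhysics.QuantumFieldTheory
open Literature.MathematicalPhysics.QuantumLattice
open Summit.QuantumFields.YangMills.Theorems.FemtoTransferGap
open Summit.QuantumFields.YangMills.Theorems.FemtoTransferGap.TwoLattice
open Summit.QuantumFields.YangMills.Theorems.FemtoTransferGap.TwoLattice.Cov (stepActionErr stepActionErr_nonneg)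
open Summit.QuantumFields.YangMills.Theorems.FemtoTransferGap.TwoLattice.ConstTube (coreEta coreEps1 coreEps2 btLog one_le_btLog coreEps1_nonneg coreEps2_nonneg
  coreEta_nonneg)
open Summit.QuantumFields.YangMills.Theorems.TwistedTraceScaling.Negative

namespace Summit.QuantumFields.YangMills.Theorems.TwistedTraceScaling.Negative.R53S

variable {L : ℕ} [NeZero L]

/-! ## §1 The action term does not see the radii -/

/-- `coreEta L β 0 0 T 0 0 σ ≤ coreEta L β δ α T R Γ σ` for `β, δ, α, Γ, σ ≥ 0` (the difference is a sum of nonnegative monomials). [folklore] -/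
theorem coreEta_zero_le {β δ α T R Γ σ : ℝ} (hβ : 0 ≤ β) (hδ : 0 ≤ δ) (hα : 0 ≤ α) (hΓ : 0 ≤ Γ) (hσ : 0 ≤ σ) :
    coreEta L β 0 0 T 0 0 σ ≤ coreEta L β δ α T R Γ σ := by
  have key : coreEta L β δ α T R Γ σ - coreEta L β 0 0 T 0 0 σ =
      β * ((Fintype.card (Edge 3 L) : ℝ) * (558 * α ^ 2 * T ^ 2 + 192 * α * T ^ 2) + 216 * α * δ * Γ) +
        β / 2 * (100 * σ * (Fintype.card (Plaquette 3 L × Fin 3) : ℝ) * R ^ 2 + 10080 * α * (Fintype.card (Plaquette 3 L × Fin 3) : ℝ) * R ^ 2) := by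
    unfold coreEta; ring
  have hE : (0 : ℝ) ≤ (Fintype.card (Edge 3 L) : ℝ) := Nat.cast_nonneg _
  have hN : (0 : ℝ) ≤ (Fintype.card (Plaquette 3 L × Fin 3) : ℝ) := Nat.cast_nonneg _
  have h1 : 0 ≤ β * ((Fintype.card (Edge 3 L) : ℝ) * (558 * α ^ 2 * T ^ 2 + 192 * α * T ^ 2) + 216 * α * δ * Γ) := by
    apply mul_nonneg hβ; apply add_nonneg (mul_nonneg hE (by positivity)) (by positivity)
  have h2 : 0 ≤ β / 2 * (100 * σ * (Fintype.card (Plaquette 3 L × Fin 3) : ℝ) * R ^ 2 + 10080 * α * (Fintype.card (Plaquette 3 L × Fin 3) : ℝ) * R ^ 2) := by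
    positivity
  linarith

/-- The core exponent `η = coreEta + coreEps1 + coreEps2` of `core_transfer_defect_le` dominates `coreEta L β 0 0 T 0 0 σ` (`β, δ, δu, T, Γ, σ ≥ 0`). [folklore] -/
theorem exponent_ge_coreEta_zero {β δ δu T R Γ σ : ℝ} (hβ : 0 ≤ β) (hδ : 0 ≤ δ) (hδu : 0 ≤ δu) (hT : 0 ≤ T) (hΓ : 0 ≤ Γ) (hσ : 0 ≤ σ) :
    coreEta L β 0 0 T 0 0 σ ≤ coreEta L β δ (δ + δu) T R Γ σ + coreEps1 L β δ T R + coreEps2 L β δ T R σ := by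
  have h0 := coreEta_zero_le (L := L) (T := T) (R := R) hβ hδ (add_nonneg hδ hδu) hΓ hσ
  have h1 := coreEps1_nonneg (L := L) (R := R) hβ hδ hT
  have h2 := coreEps2_nonneg (L := L) (δ := δ) (R := R) hβ hT hσ
  linarith

/-! ## §2 The defect constant dominates both the exponent and `η_c` -/

/-- `η ≤ max (1 − e^{−η}(1 − η_c)) (e^{η}(1 + η_c) − 1)` for `η_c ≥ 0`. [folklore] -/
theorem le_defectConst {η ηc : ℝ} (hηc : 0 ≤ ηc) :
    η ≤ max (1 - Real.exp (-η) * (1 - ηc)) (Real.exp η * (1 + ηc) - 1) := by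
  refine le_trans ?_ (le_max_right _ _)
  have h1 := Real.add_one_le_exp η
  have h2 : 0 ≤ Real.exp η * ηc := mul_nonneg (Real.exp_pos η).le hηc
  nlinarith

/-- `η_c ≤ max (1 − e^{−η}(1 − η_c)) (e^{η}(1 + η_c) − 1)` for `η ≥ 0`, `η_c ≥ 0`. [folklore] -/
theorem etac_le_defectConst {η ηc : ℝ} (hη : 0 ≤ η) (hηc : 0 ≤ ηc) :
    ηc ≤ max (1 - Real.exp (-η) * (1 - ηc)) (Real.exp η * (1 + ηc) - 1) := by
  refine le_trans ?_ (le_max_right _ _)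
  have h1 : 1 ≤ Real.exp η := Real.one_le_exp hη
  nlinarith

/-! ## §3 ★★★ On schedule B with action ceiling `β^{-1/3}` the core-defect constant cannot meet `hb_small` -/

/-- ★★ **ANY RATE DOMINATING A MULTIPLE OF THE CORE EXPONENT FAILS `hb_small`** (schedule B, `σ = powScale (1/3) β`; all radii `δ, δu ≥ 0`, all `R`, all `Γ ≥ 0`,
every `c > 0`). [cite: Luscher1983, §3] -/
theorem not_hb_small_of_scaled_exponent {δ δu R Γ b : ℝ → ℝ} {c : ℝ} (hc : 0 < c) (hδ : ∀ β, 0 ≤ δ β) (hδu : ∀ β, 0 ≤ δu β) (hΓ : ∀ β, 0 ≤ Γ β)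
    (hfloor : ∀ᶠ β : ℝ in atTop,
      c * (coreEta L β (δ β) (δ β + δu β) (9 * (L : ℝ) * (5 * (powScale (1 / 2) β * btLog β ^ 2)) + powScale 1 β) (R β) (Γ β) (powScale (1 / 3) β) +
          coreEps1 L β (δ β) (9 * (L : ℝ) * (5 * (powScale (1 / 2) β * btLog β ^ 2)) + powScale 1 β) (R β) +
          coreEps2 L β (δ β) (9 * (L : ℝ) * (5 * (powScale (1 / 2) β * btLog β ^ 2)) + powScale 1 β) (R β) (powScale (1 / 3) β)) ≤ b β) :
    ¬ ∀ a : ℝ, 0 < a → ∀ᶠ β : ℝ in atTop, b β ^ 2 ≤ a * bareLambda ((L : ℝ) ^ 3 * β) := by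
  intro H
  -- the scaled rate `b/c` dominates the zero-radii `coreEta`, to which R53 applies
  have hfloor' : ∀ᶠ β : ℝ in atTop,
      coreEta L β 0 ((fun _ => (0 : ℝ)) β) (9 * (L : ℝ) * (5 * (powScale (1 / 2) β * btLog β ^ 2)) + powScale 1 β) ((fun _ => (0 : ℝ)) β)
        ((fun _ => (0 : ℝ)) β) (powScale (1 / 3) β) ≤ b β / c := by
    filter_upwards [hfloor, eventually_ge_atTop (0 : ℝ)] with β hb hβ
    have hT0 := R52.schedT_nonneg (L := L) β
    have h := exponent_ge_coreEta_zero (L := L) (R := R β) hβ (hδ β) (hδu β) hT0 (hΓ β) (powScale_pos (1 / 3) β).le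
    rw [le_div_iff₀ hc]
    nlinarith
  refine R53.not_hb_small_of_action_third (L := L) (δu := fun _ => 0) (R := fun _ => 0) (Γ := fun _ => 0) (bOD := fun β => b β / c)
    (fun _ => le_rfl) hfloor' ?_
  intro a ha
  filter_upwards [H (a * c ^ 2) (by positivity)] with β hb
  rw [div_pow, div_le_iff₀ (by positivity)]
  nlinarith

/-- ★★★ **THE CORE-DEFECT CONSTANT OF `core_transfer_defect_le` CANNOT MEET `hb_small`** (schedule B, action ceiling `σ = powScale (1/3) β`; all radii, all `η_c ≥ 0`
eventually, every constant `c > 0`). [cite: Luscher1983, §3] [cite: SjostrandZworski2007, §2] -/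
theorem not_hb_small_of_coreDefect_third {δ δu R Γ ηc b : ℝ → ℝ} {c : ℝ} (hc : 0 < c) (hδ : ∀ β, 0 ≤ δ β) (hδu : ∀ β, 0 ≤ δu β) (hΓ : ∀ β, 0 ≤ Γ β)
    (hηc : ∀ᶠ β : ℝ in atTop, 0 ≤ ηc β)
    (hfloor : ∀ᶠ β : ℝ in atTop,
      c * max (1 - Real.exp (-(coreEta L β (δ β) (δ β + δu β) (9 * (L : ℝ) * (5 * (powScale (1 / 2) β * btLog β ^ 2)) + powScale 1 β) (R β) (Γ β) (powScale (1 / 3) β) +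
            coreEps1 L β (δ β) (9 * (L : ℝ) * (5 * (powScale (1 / 2) β * btLog β ^ 2)) + powScale 1 β) (R β) +
            coreEps2 L β (δ β) (9 * (L : ℝ) * (5 * (powScale (1 / 2) β * btLog β ^ 2)) + powScale 1 β) (R β) (powScale (1 / 3) β))) * (1 - ηc β))
          (Real.exp (coreEta L β (δ β) (δ β + δu β) (9 * (L : ℝ) * (5 * (powScale (1 / 2) β * btLog β ^ 2)) + powScale 1 β) (R β) (Γ β) (powScale (1 / 3) β) +
            coreEps1 L β (δ β) (9 * (L : ℝ) * (5 * (powScale (1 / 2) β * btLog β ^ 2)) + powScale 1 β) (R β) +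
            coreEps2 L β (δ β) (9 * (L : ℝ) * (5 * (powScale (1 / 2) β * btLog β ^ 2)) + powScale 1 β) (R β) (powScale (1 / 3) β)) * (1 + ηc β) - 1) ≤ b β) :
    ¬ ∀ a : ℝ, 0 < a → ∀ᶠ β : ℝ in atTop, b β ^ 2 ≤ a * bareLambda ((L : ℝ) ^ 3 * β) := by
  refine not_hb_small_of_scaled_exponent (L := L) (R := R) hc hδ hδu hΓ ?_
  filter_upwards [hfloor, hηc] with β hb h0
  exact le_trans (mul_le_mul_of_nonneg_left (le_defectConst h0) hc.le) hb

/-- The (OD) budget clause (`…InnerTwoZoneBudget.offDiag_budget_of_core`) is false for the core-defect constant itself (every real `ε, θ`; all radii, `η_c ≥ 0`).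
[cite: Luscher1983, §3] -/
theorem core_defect_budget_false {δ δu R Γ ηc : ℝ → ℝ} (hδ : ∀ β, 0 ≤ δ β) (hδu : ∀ β, 0 ≤ δu β) (hΓ : ∀ β, 0 ≤ Γ β) (hηc : ∀ β, 0 ≤ ηc β) (ε θ : ℝ) :
    ¬ ∃ β0 : ℝ, ∀ β : ℝ, β0 ≤ β → ∃ b : ℝ,
      max (1 - Real.exp (-(coreEta L β (δ β) (δ β + δu β) (9 * (L : ℝ) * (5 * (powScale (1 / 2) β * btLog β ^ 2)) + powScale 1 β) (R β) (Γ β) (powScale (1 / 3) β) +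
            coreEps1 L β (δ β) (9 * (L : ℝ) * (5 * (powScale (1 / 2) β * btLog β ^ 2)) + powScale 1 β) (R β) +
            coreEps2 L β (δ β) (9 * (L : ℝ) * (5 * (powScale (1 / 2) β * btLog β ^ 2)) + powScale 1 β) (R β) (powScale (1 / 3) β))) * (1 - ηc β))
          (Real.exp (coreEta L β (δ β) (δ β + δu β) (9 * (L : ℝ) * (5 * (powScale (1 / 2) β * btLog β ^ 2)) + powScale 1 β) (R β) (Γ β) (powScale (1 / 3) β) +
            coreEps1 L β (δ β) (9 * (L : ℝ) * (5 * (powScale (1 / 2) β * btLog β ^ 2)) + powScale 1 β) (R β) +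
            coreEps2 L β (δ β) (9 * (L : ℝ) * (5 * (powScale (1 / 2) β * btLog β ^ 2)) + powScale 1 β) (R β) (powScale (1 / 3) β)) * (1 + ηc β) - 1) ≤ b ∧
        b ^ 2 ≤ ε * θ * bareLambda ((L : ℝ) ^ 3 * β) / 16 := by
  rintro ⟨β0, h⟩
  refine R53.sched_action_budget_false_at_third (L := L) (δu := fun _ => 0) (R := fun _ => 0) (Γ := fun _ => 0) (fun _ => le_rfl) ε θ
    ⟨max β0 0, fun β hβ => ?_⟩
  obtain ⟨b, hb, hb2⟩ := h β ((le_max_left _ _).trans hβ)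
  have hβ0 : 0 ≤ β := (le_max_right _ _).trans hβ
  have hT0 := R52.schedT_nonneg (L := L) β
  have h1 := exponent_ge_coreEta_zero (L := L) (R := R β) hβ0 (hδ β) (hδu β) hT0 (hΓ β) (powScale_pos (1 / 3) β).le
  have h2 := le_defectConst (hηc β)
    (η := coreEta L β (δ β) (δ β + δu β) (9 * (L : ℝ) * (5 * (powScale (1 / 2) β * btLog β ^ 2)) + powScale 1 β) (R β) (Γ β) (powScale (1 / 3) β) +
            coreEps1 L β (δ β) (9 * (L : ℝ) * (5 * (powScale (1 / 2) β * btLog β ^ 2)) + powScale 1 β) (R β) +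
            coreEps2 L β (δ β) (9 * (L : ℝ) * (5 * (powScale (1 / 2) β * btLog β ^ 2)) + powScale 1 β) (R β) (powScale (1 / 3) β))
  exact ⟨b, le_trans (le_trans h1 h2) hb, hb2⟩

/-- The floor in numbers: `ε ≥ η ≥ 1728·2025·N_P·L²·ℓ⁴·β^{-1/6}` (one action term suffices, R53 `coreEta_ge_action_third`), while `hb_small` needs `b = o(β^{-1/6})`:
`(1/3)/2 = 1/6` and `2·(1/6) = 1/3` = the exponent of `λ_b`. [folklore] -/
example : (1 : ℝ) / 3 / 2 = 1 / 6 ∧ 2 * ((1 : ℝ) / 6) = 1 / 3 ∧ (1728 : ℝ) * 2025 = 3499200 := by norm_num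

end Summit.QuantumFields.YangMills.Theorems.TwistedTraceScaling.Negative.R53S

end
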